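import Mathlib
import Literature.LinearAlgebra.Matrix.SylvesterDeterminantIdentity
import Summits.ValiantsHypothesis.ValiantsHypothesis.Theorems.LacunarySymmetroidMatrixDescartesCensusDefs
import Summits.ValiantsHypothesis.ValiantsHypothesis.Theorems.KPlusLogSqLawWeakLiftingTowerGraftSylvesterCompression

/-!
# Tower graft line — the MINOR PENCIL as a lacunary pencil on the sumset (typing substrate of T5)

Mechanism piece for LINE (B) `Cruxes/WeakLifting/Lines/tower_graft.lean` (rev 9; crux `WeakLifting` = stmt-ValiantsHypothesis-19561,
restricted sub-case `TowerWeakLifting`), S4f / T5 side; named by the line planner val-idea-24 g0 (2026-08-28 18:54Z, handles (h0)–(h2))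
and the desk (R2743 (A): «the tower application of T5 … with the s-fold-sumset support statement of the bordered pencil»).  NO registered
stub is closed by this file (S4f/T5 stay research).  Builds on val-sym-lift-p2 g18's `…TowerGraftSylvesterCompression`
(`borderedMinors_pencil_apply`, `det_pencil_eq_sum`, `submatrix_pencil`) and the tree's `Literature/…/SylvesterDeterminantIdentity`.

* (h0) `det_submatrix_pencil_eq_sum` — column-multilinear expansion of any minor of a pencil `Σₗ X^{dₗ} Tₗ`:
  `det (G[ρ,γ]) = Σ_{f : ν → Fin K} X^{Σ_a d (f a)} · det [column b from T_{f b}]`; `borderedMinors_pencil_eq_sum` — hence the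
  Sylvester bordered-minor matrix of the pencil split along `e : ι ⊕ μ ≃ Fin N` IS A LACUNARY PENCIL
  `𝔅 = Σ_{f : ι ⊕ Unit → Fin K} X^{Σ_a d (f a)} • T_f` with explicit real letters `T_f` (exponents = the `(|ι|+1)`-fold sumset of `d`).
* (h1) `card_image_sumExp_le` — the LETTER COUNT: the exponents take at most `C(K + |ν| − 1, |ν|)` values (stars and bars through
  `Sym (Fin K) |ν|`); at `|ν| = s` this is `C(K+s−1, s)` — recorded so that nobody budgets `𝔅` per letter.
* (h2) `minorPencil_constLetter` — the EXTREME DIGIT LETTERS `T_{f ≡ l}` are the bordered-minor matrices of the single constant letters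
  `Sₗ` (same split), hence `det Sₗ[ι] • (Sₗ / Sₗ[ι])` by `Literature.….borderedMinors_eq_det_smul_schurCompl` when that pivot is a unit —
  the first «Plücker-type constraint» made nameable (definite `Sₗ` ⇒ semidefinite extreme letter, up to the pivot sign).
* (h0d) `card_posRoots_minorPencil_le_of_posRootLawOn_sumset` — the CENSUS-CURRENCY EMBEDDING at the tower split
  `Fin m ⊕ Fin (m+1) ≃ Fin (m+1+m)`: for symmetric letters, `2 • 𝔅 = Σ_f X^{e_f} • (T_f + T_fᵀ)` is a size-`(m+1)` lacunary pencil with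
  SYMMETRIC letters (indexed by `Fin K'`, `K' = K^{m+1}`, via `Fintype.equivFin`) on the sumset exponents, so every support-level budget
  `PosRootLawOn (m+1) K' B' (sumset)` bounds `Z₊(det 𝔅)`.  LOCATED NEGATIVE (evidence memo on stmt-19561): as a LAW for all fat towers this
  class reading is FALSE for every constant (diagonal designs on the sumset are `(m+1)·(C(K+m,m+1)−1)`-rich, Descartes being sharp on every
  support, against TowerB through the spine) — so (h0d) is the bridge of that refutation and T5 must be charged by the MINOR structure of `𝔅`.

Def-free.  HONEST FRAMING: vocabulary for a research statement (T5) of a skeleton for a RESTRICTED sub-case; proves no stub and nothing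
about `WeakLifting`, Conjecture B / `KPlusLogSqLaw`, `MatrixDescartes` (18050) or `VP ≠ VNP`.
Seat: prover val-sym-lift-p3 g17, `--supports stmt-ValiantsHypothesis-19561`.
-/

-- `Summit.ValiantsHypothesis.ValiantsHypothesis.…` repeats a component by the D-0017 layout
-- (single-conjunct summit), which the `dupNamespace` linter flags; the name is mandated.
set_option linter.dupNamespace false

namespace Summit.ValiantsHypothesis.ValiantsHypothesis.Theorems.KPlusLogSqLaw.TowerGraft

open Finset Polynomial Matrix
open scoped BigOperators Polynomial
open Literature.LinearAlgebra.Matrix (borderedMinors)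

/-! ### FILE A: the minor pencil as a LACUNARY PENCIL on the `(|ι|+1)`-fold sumset (letter decomposition, letter count, extreme letters) -/

section MinorPencil

variable {K : ℕ}

/-- **column-multilinear expansion of a pencil minor**: any `ν × ν` minor of the pencil `Σₗ X^{dₗ} Tₗ` is the lacunary polynomial
`Σ_{f : ν → Fin K} X^{Σ_a d (f a)} · det [column b taken from the letter T_{f b}]`. [folklore] -/
theorem det_submatrix_pencil_eq_sum {ν : Type*} [Fintype ν] [DecidableEq ν] {N : ℕ} (d : Fin K → ℕ)
    (T : Fin K → Matrix (Fin N) (Fin N) ℝ) (ρ γ : ν → Fin N) :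
    ((∑ l, ((X : ℝ[X]) ^ d l) • (T l).map Polynomial.C).submatrix ρ γ).det =
      ∑ f : ν → Fin K, (X : ℝ[X]) ^ (∑ a, d (f a)) *
        Polynomial.C (Matrix.det (Matrix.of fun a b => T (f b) (ρ a) (γ b))) := by
  rw [submatrix_pencil, det_pencil_eq_sum, Finset.sum_comm]
  refine Finset.sum_congr rfl fun f _ => ?_
  rw [Matrix.det_apply', map_sum, Finset.mul_sum]
  refine Finset.sum_congr rfl fun σ _ => ?_
  rw [map_mul, map_intCast]
  simp only [Matrix.submatrix_apply, Matrix.of_apply]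
  ring

/-- **THE MINOR PENCIL IS A LACUNARY PENCIL ON THE SUMSET (letter decomposition).**  For the `N`-pencil `G = Σₗ X^{dₗ} Sₗ` split
along `e : ι ⊕ μ ≃ Fin N`, the bordered-minor matrix is `𝔅 = Σ_{f : ι ⊕ Unit → Fin K} X^{Σ_a d (f a)} • T_f` with the REAL letters
`T_f[i,j] = det [column b of the bordered minor (i,j) taken from S_{f b}]` — exponents = the `(|ι|+1)`-fold sumset of `d`
(refines `coeff_borderedMinors_pencil_eq_zero`). [this work] -/
theorem borderedMinors_pencil_eq_sum {ι μ : Type*} [Fintype ι] [DecidableEq ι] {N : ℕ} (e : ι ⊕ μ ≃ Fin N) (d : Fin K → ℕ)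
    (S : Fin K → Matrix (Fin N) (Fin N) ℝ) :
    let A := (∑ l, ((X : ℝ[X]) ^ d l) • (S l).map Polynomial.C).submatrix e e
    borderedMinors A.toBlocks₁₁ A.toBlocks₁₂ A.toBlocks₂₁ A.toBlocks₂₂ =
      ∑ f : ι ⊕ Unit → Fin K, ((X : ℝ[X]) ^ (∑ a, d (f a))) •
        (Matrix.of fun i j : μ => Matrix.det (Matrix.of fun a b : ι ⊕ Unit =>
          S (f b) (e (Sum.map id (fun _ : Unit => i) a)) (e (Sum.map id (fun _ : Unit => j) b)))).map Polynomial.C := by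
  intro A
  ext i j
  rw [borderedMinors_pencil_apply, ← submatrix_pencil, det_submatrix_pencil_eq_sum]
  simp only [Matrix.sum_apply, Matrix.smul_apply, Matrix.map_apply, Matrix.of_apply, smul_eq_mul, Function.comp_apply]

/-- **LETTER COUNT of the minor pencil**: the exponents `Σ_a d (f a)`, `f : ν → Fin K`, take at most `C(K + |ν| − 1, |ν|)` values
(they only depend on the multiset of values of `f`; stars and bars) — for the `s × s` minor pencil of a `K`-letter pencil this is
`C(K + s − 1, s)`, NOT to be charged per letter. [folklore] -/
theorem card_image_sumExp_le {ν : Type*} [Fintype ν] [DecidableEq ν] (d : Fin K → ℕ) :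
    (Finset.univ.image fun f : ν → Fin K => ∑ a, d (f a)).card ≤ Nat.choose (K + Fintype.card ν - 1) (Fintype.card ν) := by
  classical
  -- factor through the multiset of values, a point of `Sym (Fin K) |ν|`
  have hfac : ∀ f : ν → Fin K, (∑ a, d (f a)) =
      (((⟨Finset.univ.val.map f, by simp⟩ : Sym (Fin K) (Fintype.card ν)) : Multiset (Fin K)).map d).sum := by
    intro f
    rw [Finset.sum_eq_multiset_sum, Multiset.map_map]
    rfl
  have hsub : (Finset.univ.image fun f : ν → Fin K => ∑ a, d (f a)) ⊆
      Finset.univ.image (fun s : Sym (Fin K) (Fintype.card ν) => ((s : Multiset (Fin K)).map d).sum) := by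
    intro x hx
    obtain ⟨f, -, rfl⟩ := Finset.mem_image.mp hx
    exact Finset.mem_image.mpr ⟨⟨Finset.univ.val.map f, by simp⟩, Finset.mem_univ _, (hfac f).symm⟩
  refine (Finset.card_le_card hsub).trans (Finset.card_image_le.trans ?_)
  rw [Finset.card_univ, Sym.card_sym_eq_choose, Fintype.card_fin]

/-- **THE EXTREME DIGIT LETTERS are bordered-minor matrices of single letters**: for the constant colouring `f ≡ l` the letter
`T_f` of the minor pencil is the bordered-minor matrix of the CONSTANT matrix `Sₗ` (split along the same `e`), hence
`= det (Sₗ[ι]) • (Sₗ / Sₗ[ι])` (Schur complement) when that pivot is invertible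
(`Literature.LinearAlgebra.Matrix.borderedMinors_eq_det_smul_schurCompl`). [this work] -/
theorem minorPencil_constLetter {ι μ : Type*} [Fintype ι] [DecidableEq ι] {N : ℕ} (e : ι ⊕ μ ≃ Fin N)
    (S : Fin K → Matrix (Fin N) (Fin N) ℝ) (l : Fin K) :
    (Matrix.of fun i j : μ => Matrix.det (Matrix.of fun a b : ι ⊕ Unit =>
        S ((fun _ : ι ⊕ Unit => l) b) (e (Sum.map id (fun _ : Unit => i) a)) (e (Sum.map id (fun _ : Unit => j) b)))) =
      borderedMinors ((S l).submatrix e e).toBlocks₁₁ ((S l).submatrix e e).toBlocks₁₂ ((S l).submatrix e e).toBlocks₂₁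
        ((S l).submatrix e e).toBlocks₂₂ := by
  ext i j
  rw [borderedMinors_toBlocks_apply, Matrix.submatrix_submatrix]
  rfl

/-- transpose of the letter decomposition: `𝔅ᵀ = Σ_f X^{e_f} • T_fᵀ`. [folklore] -/
theorem transpose_sum_smul_map {μ : Type*} {κ : Type*} [Fintype κ] (c : κ → ℝ[X]) (T : κ → Matrix μ μ ℝ) :
    (∑ f, c f • (T f).map Polynomial.C)ᵀ = ∑ f, c f • ((T f)ᵀ).map Polynomial.C := by
  rw [Matrix.transpose_sum]
  refine Finset.sum_congr rfl fun f _ => ?_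
  rw [Matrix.transpose_smul, Matrix.transpose_map]

/-- **CENSUS-CURRENCY EMBEDDING of the minor pencil (tower application, split `Fin m ⊕ Fin (m+1) ≃ Fin (m+1+m)`).**  For SYMMETRIC
letters `S` the minor pencil `𝔅` is symmetric, so `2 • 𝔅 = Σ_f X^{e_f} • (T_f + T_fᵀ)` is a lacunary pencil of size `m + 1` with
SYMMETRIC real letters indexed (through `Fintype.equivFin`) by `Fin K'`, `K' = |Fin m ⊕ Unit → Fin K| = K^{m+1}`, on the sumset
exponents; hence any support-level budget `PosRootLawOn (m+1) K' B' (sumset exponents)` bounds `Z₊(det 𝔅)` (`det (2 • 𝔅)` has the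
roots of `det 𝔅`).  This is the CLASS (census-currency) reading of T5 — and the BRIDGE of its refutation: as a law for all fat tower
formats («`PosRootLawOn (m+1) K B d →` the sumset budget `(m+2)^C·B + 2^{C·log₂²(m+1)}`») it is FALSE for every `C` (diagonal designs on
the sumset are `(m+1)·(|E|−1)`-rich, Descartes being sharp on every support, while this implication + `sizeDoublingPoly_of_minorPencilLaw` +
the spine would give TowerB; evidence memo on stmt-19561, lift-p3 g17).  So a true T5 must use that the letters of `𝔅` are MINOR-structured,
not only where they are supported; the implication below is what makes that precise. [this work] -/
theorem card_posRoots_minorPencil_le_of_posRootLawOn_sumset {m B' : ℕ} (d : Fin K → ℕ)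
    (hlaw : Summit.ValiantsHypothesis.ValiantsHypothesis.Theorems.LacunarySymmetroidMatrixDescartes.PosRootLawOn (m + 1)
      (Fintype.card (Fin m ⊕ Unit → Fin K)) B'
      (fun q => ∑ a, d ((Fintype.equivFin (Fin m ⊕ Unit → Fin K)).symm q a)))
    (S : Fin K → Matrix (Fin (m + 1 + m)) (Fin (m + 1 + m)) ℝ) (hS : ∀ l, (S l).IsSymm) :
    let A := (∑ l, ((X : ℝ[X]) ^ d l) • (S l).map Polynomial.C).submatrix
      (finSumFinEquiv.trans (finCongr (Nat.add_comm m (m + 1))))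
      (finSumFinEquiv.trans (finCongr (Nat.add_comm m (m + 1))))
    ((borderedMinors A.toBlocks₁₁ A.toBlocks₁₂ A.toBlocks₂₁ A.toBlocks₂₂).det.roots.toFinset.filter (fun t => 0 < t)).card ≤ B' := by
  intro A
  set e := finSumFinEquiv.trans (finCongr (Nat.add_comm m (m + 1))) with he
  set σ := Fintype.equivFin (Fin m ⊕ Unit → Fin K) with hσ
  -- the letters of the minor pencil and their symmetrisation
  set T : (Fin m ⊕ Unit → Fin K) → Matrix (Fin (m + 1)) (Fin (m + 1)) ℝ := fun f =>
    Matrix.of fun i j : Fin (m + 1) => Matrix.det (Matrix.of fun a b : Fin m ⊕ Unit =>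
      S (f b) (e (Sum.map id (fun _ : Unit => i) a)) (e (Sum.map id (fun _ : Unit => j) b))) with hT
  have hB : borderedMinors A.toBlocks₁₁ A.toBlocks₁₂ A.toBlocks₂₁ A.toBlocks₂₂ =
      ∑ f, ((X : ℝ[X]) ^ (∑ a, d (f a))) • (T f).map Polynomial.C := borderedMinors_pencil_eq_sum e d S
  have hBsymm : (borderedMinors A.toBlocks₁₁ A.toBlocks₁₂ A.toBlocks₂₁ A.toBlocks₂₂).IsSymm := by
    have hGsymm : (∑ l, ((X : ℝ[X]) ^ d l) • (S l).map Polynomial.C).IsSymm := by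
      rw [Matrix.IsSymm, Matrix.transpose_sum]
      refine Finset.sum_congr rfl fun l _ => ?_
      rw [Matrix.transpose_smul, ← Matrix.transpose_map, (hS l).eq]
    exact isSymm_borderedMinors_toBlocks (hGsymm.submatrix e)
  -- the symmetrised pencil, reindexed by `Fin K'`, is `𝔅 + 𝔅ᵀ = 2 • 𝔅`
  have hsum : (∑ q, ((Polynomial.X : Polynomial ℝ) ^ (∑ a, d (σ.symm q a))) • (T (σ.symm q) + (T (σ.symm q))ᵀ).map Polynomial.C) =
      (2 : ℝ[X]) • borderedMinors A.toBlocks₁₁ A.toBlocks₁₂ A.toBlocks₂₁ A.toBlocks₂₂ := by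
    rw [σ.symm.sum_comp (fun f => ((X : ℝ[X]) ^ (∑ a, d (f a))) • (T f + (T f)ᵀ).map Polynomial.C)]
    calc (∑ f, ((X : ℝ[X]) ^ (∑ a, d (f a))) • (T f + (T f)ᵀ).map Polynomial.C)
        = (∑ f, ((X : ℝ[X]) ^ (∑ a, d (f a))) • (T f).map Polynomial.C) +
            ∑ f, ((X : ℝ[X]) ^ (∑ a, d (f a))) • ((T f)ᵀ).map Polynomial.C := by
          rw [← Finset.sum_add_distrib]
          refine Finset.sum_congr rfl fun f _ => ?_
          have hadd : (T f + (T f)ᵀ).map Polynomial.C = (T f).map Polynomial.C + ((T f)ᵀ).map Polynomial.C := by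
            ext i j
            simp only [Matrix.map_apply, Matrix.add_apply, map_add]
          rw [hadd, smul_add]
      _ = borderedMinors A.toBlocks₁₁ A.toBlocks₁₂ A.toBlocks₂₁ A.toBlocks₂₂ +
            (borderedMinors A.toBlocks₁₁ A.toBlocks₁₂ A.toBlocks₂₁ A.toBlocks₂₂)ᵀ := by
          rw [hB, transpose_sum_smul_map]
      _ = (2 : ℝ[X]) • borderedMinors A.toBlocks₁₁ A.toBlocks₁₂ A.toBlocks₂₁ A.toBlocks₂₂ := by
          rw [hBsymm.eq, two_smul]
  have happ := hlaw (fun q => T (σ.symm q) + (T (σ.symm q))ᵀ) (fun q => Matrix.isSymm_add_transpose_self _)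
  rw [hsum, Matrix.det_smul, Fintype.card_fin] at happ
  have h2 : ((2 : ℝ[X]) ^ (m + 1)) = Polynomial.C ((2 : ℝ) ^ (m + 1)) := by
    rw [Polynomial.C_pow]
    rfl
  rwa [h2, Polynomial.roots_C_mul _ (pow_ne_zero _ two_ne_zero)] at happ

end MinorPencil

end Summit.ValiantsHypothesis.ValiantsHypothesis.Theorems.KPlusLogSqLaw.TowerGraft
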